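import Literature.Barriers.CriticalPhenomena.PlaquetteWalkKissLoopSeparation
import HarnessLib

/-!
# Barrier catalogue (SAWScalingLimit): the JUMP of the kiss loop's winding number across its chord («KISS LOOP JUMP»)

`Z → ∞` limit model of the printed Yang–Baxter weights [GlazmanManolescu2019, §1, eq. (1)]; TAIL LEMMA infrastructure of the «RECTANGLE COEFFICIENT» line
(b-engine-1 g25, DESIGN-next-g25 §2bis / DESIGN-K-separator-jump.md), on top of `PlaquetteWalkKissLoop` / `PlaquetteWalkKissLoopSeparation`.

★★ `YBWalk.windK_jump_core` — the abstract jump: if a segment `ℓ r` crosses the CHORD of the kiss loop transversally (the chord's ends strictly on opposite sides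
of the line `ℓ r`, the two segments meeting in the open segment `ℓ r`) and misses every other closed edge of the loop, then `windK ℓ − windK r = 1`
(`wind_sub_wind_of_straight_cross` on the polygon parametrisation whose last edge is the chord — verbatim the pattern of `ΩG.windC_jump`).
[AhlforsCA1979, Ch. 4 §2.1] [CourantRobbins1958, Ch. V Appendix §2] [GlazmanManolescu2019 §1 Fig. 1, eq. (1)]
-/

noncomputable section

open Set Function Complex
open Literature.Topology.PlaneTopology

namespace Literature.Probability.RandomPlanarGeometry.SAW.YangBaxter

open private mem_segment_toC arcSeg_disjoint_faceBox crossSeg_faceBox segment_subset_faceBox crossSeg_side_eq' segSide_toC segSideZ_add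
  from Literature.Probability.RandomPlanarGeometry.YangBaxterSAWExcursionJordan

namespace YBWalk

variable {D : Set Face} {a z : MidEdge} {γ : YBWalk D a z} {ta tb : ℕ}

/-- The vertex list is nonempty. [folklore] -/
private theorem kList_pos' : 0 < (γ.kList ta tb).length := by rw [length_kList, kN]; omega

/-- The cyclically next vertex. [folklore] -/
private theorem kList_getElem_succ' (k : ℕ) :
    (γ.kList ta tb)[(k + 1) % (γ.kList ta tb).length]'(Nat.mod_lt _ kList_pos') = toC (γ.kPt ta ((k + 1) % kN ta tb)) := by
  rw [kList_getElem]; simp only [length_kList]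

/-- ★★ **The jump of the kiss loop's winding number across its chord** (abstract form): a segment `ℓ r` crossing the chord `ptIn tb → ptIn ta` transversally
— the chord's start strictly to the left of the line `ℓ r`, its end strictly to the right, the two segments meeting in the open segment `ℓ r` — and missing every
other closed edge of the loop has `windK ℓ − windK r = 1`. [cite: AhlforsCA1979, Ch. 4 §2.1 (index of a point with respect to a closed curve)]
[cite: CourantRobbins1958, Ch. V Appendix §2 (The Jordan Curve Theorem for Polygons: the even–odd rule)] -/
theorem windK_jump_core (hab : ta < tb) {ℓ r : ℂ}
    (hmiss : ∀ k, k + 1 < kN ta tb → ∀ x ∈ γ.kEdge ta tb k, x ∉ segment ℝ ℓ r)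
    (hA : 0 < segSide ℓ r (toC (γ.ptIn tb))) (hB : segSide ℓ r (toC (γ.ptIn ta)) < 0)
    (hx : ∃ p ∈ segment ℝ (toC (γ.ptIn tb)) (toC (γ.ptIn ta)), p ∈ openSegment ℝ ℓ r) :
    γ.windK ta tb ℓ - γ.windK ta tb r = 1 := by
  set l := γ.kList ta tb with hl
  set N := kN ta tb with hN
  have hN2 : N = 2 * (tb - ta) + 1 := rfl
  have hlen : l.length = N := length_kList
  have hl0 : l ≠ [] := List.ne_nil_of_length_pos kList_pos'
  have hNpos : 0 < N := by omega
  have hN3 : 3 ≤ N := by omega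
  have hNr : (0 : ℝ) < N := by exact_mod_cast hNpos
  set u : ℝ := (N - 1 : ℝ) / N with hu
  have hN1 : ((N - 1 : ℕ) : ℝ) = (N : ℝ) - 1 := by rw [Nat.cast_sub (by omega), Nat.cast_one]
  have hlenR : ((l.length : ℕ) : ℝ) = N := by rw [hlen]
  have hu0 : 0 ≤ u := div_nonneg (by linarith [show (1 : ℝ) ≤ N by exact_mod_cast hNpos]) hNr.le
  have hu1 : u < 1 := by rw [hu, div_lt_one hNr]; linarith
  set L : ℝ → ℂ := polygonLoop l with hL
  -- the ends of the chord: vertex `N - 1 = 2 (tb - ta)` is `ptIn tb`, vertex `0` is `ptIn ta`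
  have eA : l[N - 1]'(by rw [hlen]; omega) = toC (γ.ptIn tb) := by
    rw [kList_getElem, show N - 1 = 2 * (tb - ta) by omega, kPt_even, show ta + (tb - ta) = tb by omega]
  have eB : l[0]'kList_pos' = toC (γ.ptIn ta) := by
    rw [kList_getElem, show (0 : ℕ) = 2 * 0 by rfl, kPt_even, Nat.add_zero]
  have hLu : L u = toC (γ.ptIn tb) := by
    have e := polygonLoop_vertex (l := l) (k := N - 1) (by rw [hlen]; omega)
    rw [hlenR, hN1] at e
    rw [hL, hu, e, eA]
  have hL1 : L 1 = toC (γ.ptIn ta) := by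
    have e := polygonLoop_vertex (l := l) (k := 0) kList_pos'
    rw [Nat.cast_zero, zero_div] at e
    have e1 : L 1 = L 0 := by rw [hL]; simpa using periodic_polygonLoop l 0
    rw [e1, hL, e, eB]
  -- the chord is straight
  have hmid : ∀ s ∈ Icc u 1, L s = AffineMap.lineMap (L u) (L 1) ((s - u) / (1 - u)) := by
    intro s hs
    have hθ : (s - u) / (1 - u) ∈ Icc (0 : ℝ) 1 :=
      ⟨div_nonneg (by linarith [hs.1]) (by linarith), (div_le_one (by linarith)).2 (by linarith [hs.2])⟩
    have hsu : s = ((N - 1 : ℕ) + (s - u) / (1 - u)) / (l.length : ℝ) := by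
      rw [hlenR, hN1]
      have h1u : 1 - u = 1 / N := by rw [hu]; field_simp; ring
      rw [h1u]; field_simp; rw [hu]; field_simp; ring
    have hl0' : 0 < l.length := by rw [hlen]; omega
    have eB' : l[(N - 1 + 1) % l.length]'(Nat.mod_lt _ hl0') = L 1 := by
      have e0' : l[(N - 1 + 1) % l.length]'(Nat.mod_lt _ hl0') = l[0]'hl0' :=
        getElem_congr_idx (by rw [hlen, show N - 1 + 1 = N by omega, Nat.mod_self])
      rw [e0', hL1, eB]
    have e := polygonLoop_apply_div (l := l) (k := N - 1) (by rw [hlen]; omega) hθ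
    rw [← hsu, eA, ← hLu, eB'] at e
    exact e
  -- off the chord, the loop runs through the other closed edges, which miss the segment `ℓ r`
  have hout : ∀ s ∈ Icc 0 u ∪ Icc 1 1, L s ∉ segment ℝ ℓ r := by
    intro s hs hmem
    have haux : ∃ k, k + 1 < N ∧ L s ∈ γ.kEdge ta tb k := by
      rcases hs with hs | hs
      · obtain ⟨k, hk, θ, hθ, hks, hv⟩ := polygonLoop_eq_of_floor hl0 s
        have hfr : Int.fract s = s := Int.fract_eq_self.2 ⟨hs.1, lt_of_le_of_lt hs.2 hu1⟩
        rw [hfr, hlen] at hks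
        rw [hlen] at hk
        have hkθ : (k : ℝ) + θ ≤ N - 1 := by
          have := hs.2; rw [hu, ← hks, div_le_div_iff_of_pos_right hNr] at this; exact this
        by_cases hkl : k + 1 < N
        · refine ⟨k, hkl, ?_⟩
          rw [hL, hv, kList_getElem, kList_getElem_succ', kEdge, segment_eq_image_lineMap]
          exact ⟨θ, ⟨hθ.1, hθ.2.le⟩, rfl⟩
        · have hkN : k = N - 1 := by omega
          have hθ0 : θ = 0 := by
            have : (k : ℝ) = N - 1 := by rw [hkN, hN1]
            linarith [hθ.1]
          refine ⟨N - 2, by omega, ?_⟩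
          rw [hL, hv, hθ0, AffineMap.lineMap_apply_zero, kList_getElem, hkN, kEdge,
            show N - 2 + 1 = N - 1 by omega, Nat.mod_eq_of_lt (by omega)]
          exact right_mem_segment _ _ _
      · have hs1 : s = 1 := le_antisymm hs.2 hs.1
        refine ⟨0, by omega, ?_⟩
        rw [hs1, hL1, ← eB, kList_getElem, kEdge]
        exact left_mem_segment _ _ _
    obtain ⟨k, hk, hLs⟩ := haux
    exact hmiss k hk _ hLs hmem
  have key := wind_sub_wind_of_straight_cross (L := L) (a := 0) (u := u) (u' := 1) (b := 1)
    (ℓ := ℓ) (r := r) hu0 hu1 le_rfl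
    ((continuous_polygonLoop l).continuousOn) (by rw [hL]; simpa using (periodic_polygonLoop l 0).symm)
    hmid hout (by rw [hLu]; exact hA) (by rw [hL1]; exact hB) (by rw [hLu, hL1]; exact hx)
  simpa [windK] using key

/-! ## §2 The geometric jump for SEPARATOR kisses -/

/-- The closed edges of the kiss loop other than the chord: a loop arc segment or a loop crossing segment.
[cite: CourantRobbins1958, Ch. V Appendix §2 (polygons)] -/
theorem mem_kEdge_cases_lt (htb : tb < γ.arcs.length) {k : ℕ} (hk : k + 1 < kN ta tb) {x : ℂ} (hx : x ∈ γ.kEdge ta tb k) :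
    (∃ i, ta + i < tb ∧ x ∈ arcSeg (γ.fc (ta + i)) (γ.sIn (ta + i)) (γ.sOut (ta + i))) ∨
      (∃ i, ta + i + 1 ≤ tb ∧ x ∈ crossSeg (γ.nth (ta + i + 1))) := by
  rw [kN] at hk
  obtain ⟨i, rfl | rfl⟩ : ∃ i, k = 2 * i ∨ k = 2 * i + 1 := ⟨k / 2, by omega⟩
  · exact Or.inl ⟨i, by omega, by rwa [kEdge_arc (by omega)] at hx⟩
  · exact Or.inr ⟨i, by omega, by rwa [kEdge_cross (by omega) htb] at hx⟩

/-- Two lattice segments in one frame: common points give affine parameters. [folklore] -/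
private theorem seg_meet_params {b A B C E : ℤ × ℤ} {x : ℂ} (h1 : x ∈ segment ℝ (toC (b + A)) (toC (b + B)))
    (h2 : x ∈ segment ℝ (toC (b + C)) (toC (b + E))) :
    ∃ t t' : ℝ, 0 ≤ t ∧ t ≤ 1 ∧ 0 ≤ t' ∧ t' ≤ 1 ∧
      (A.1 : ℝ) + t * ((B.1 : ℝ) - A.1) = C.1 + t' * ((E.1 : ℝ) - C.1) ∧
      (A.2 : ℝ) + t * ((B.2 : ℝ) - A.2) = C.2 + t' * ((E.2 : ℝ) - C.2) := by
  obtain ⟨t, h0, h1', hx, hy⟩ := mem_segment_toC h1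
  obtain ⟨t', h0', h1'', hx', hy'⟩ := mem_segment_toC h2
  refine ⟨t, t', h0, h1', h0', h1'', ?_, ?_⟩
  · have := hx.symm.trans hx'; simp only [Prod.fst_add, Int.cast_add] at this; linarith
  · have := hy.symm.trans hy'; simp only [Prod.snd_add, Int.cast_add] at this; linarith

/-- The side vector of the before-point: the inner corner of the kiss plaquette between the two entry sides. [cite: CourantRobbins1958, Ch. V Appendix §2] -/
def kLoff (γ : YBWalk D a z) (ta tb : ℕ) : ℤ × ℤ := (γ.sIn ta).inOff + (γ.sIn tb).inOff - (2, 2)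

/-- The sides of a separator kiss: `s₂ ∉ {s₁, s₁.opp}`, `s₃ = s₂.opp`, `s₄ = s₁.opp`. [cite: GlazmanManolescu2019, §1, Fig. 1 (the configurations `w₁`, `w₂`)] -/
theorem separator_sides (hta : ta < γ.arcs.length) (htb : tb < γ.arcs.length) (hne : ta ≠ tb) (hkiss : γ.fc tb = γ.fc ta)
    (hsep : γ.sIn tb = (γ.sOut ta).opp) :
    γ.sOut ta ≠ γ.sIn ta ∧ γ.sOut ta ≠ (γ.sIn ta).opp ∧ γ.sOut tb = (γ.sIn ta).opp := by
  obtain ⟨h0, h1, h2, h3, h4⟩ := γ.not_straight_of_two_arcs hta htb hne hkiss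
  have h5 := (γ.side_sIn_nth hta).2.2
  have h6 := (γ.side_sIn_nth htb).2.2
  revert h0 h1 h2 h3 h4 h5 h6 hsep
  cases γ.sIn ta <;> cases γ.sOut ta <;> cases γ.sIn tb <;> cases γ.sOut tb <;> decide

/-- ★★ **The jump across the chord of a SEPARATOR kiss.** If the second visit enters through the side opposite to the first visit's exit (the loop leaves and
returns on opposite sides of the kiss plaquette), the winding number of the kiss loop at the inner corner between the two entry sides and at the exit inner
point of the second visit differ by one. [cite: AhlforsCA1979, Ch. 4 §2.1] [cite: CourantRobbins1958, Ch. V Appendix §2 (polygons)]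
[cite: GlazmanManolescu2019, §1, Fig. 1 (the configurations `w₁`, `w₂`)] -/
theorem windK_jump_separator (hab : ta < tb) (htb : tb < γ.arcs.length) (hkiss : γ.fc tb = γ.fc ta)
    (hsep : γ.sIn tb = (γ.sOut ta).opp) :
    γ.windK ta tb (toC ((γ.fc ta).base + γ.kLoff ta tb)) - γ.windK ta tb (toC (γ.ptOut tb)) = 1 ∨
      γ.windK ta tb (toC ((γ.fc ta).base + γ.kLoff ta tb)) - γ.windK ta tb (toC (γ.ptOut tb)) = -1 := by
  have hta : ta < γ.arcs.length := by omega
  obtain ⟨hs21, hs21', hs4⟩ := separator_sides hta htb (by omega) hkiss hsep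
  -- notation: everything relative to the base corner `b` of the kiss plaquette
  set b := (γ.fc ta).base with hb
  have ePout : γ.ptOut tb = b + (γ.sOut tb).inOff := by rw [YBWalk.ptOut, hkiss]; rfl
  have ePinb : γ.ptIn tb = b + (γ.sIn tb).inOff := by rw [YBWalk.ptIn, hkiss]; rfl
  have ePina : γ.ptIn ta = b + (γ.sIn ta).inOff := rfl
  -- the segment `ℓ r` lies in the closed kiss plaquette
  have hVbd : ∀ s₁ s₃ : Side, 0 ≤ (s₁.inOff + s₃.inOff - ((2 : ℤ), (2 : ℤ))).1 ∧ (s₁.inOff + s₃.inOff - ((2 : ℤ), (2 : ℤ))).1 ≤ 4 ∧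
      0 ≤ (s₁.inOff + s₃.inOff - ((2 : ℤ), (2 : ℤ))).2 ∧ (s₁.inOff + s₃.inOff - ((2 : ℤ), (2 : ℤ))).2 ≤ 4 := by decide
  have hIbd : ∀ s : Side, 0 ≤ s.inOff.1 ∧ s.inOff.1 ≤ 4 ∧ 0 ≤ s.inOff.2 ∧ s.inOff.2 ≤ 4 := by decide
  have hsub : segment ℝ (toC (b + γ.kLoff ta tb)) (toC (γ.ptOut tb)) ⊆ faceBox (γ.fc ta) := by
    rw [ePout]; exact segment_subset_faceBox _ (hVbd _ _) (hIbd _)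
  -- the non-chord edges miss the segment
  have hmiss : ∀ k, k + 1 < kN ta tb → ∀ x ∈ γ.kEdge ta tb k, x ∉ segment ℝ (toC (b + γ.kLoff ta tb)) (toC (γ.ptOut tb)) := by
    intro k hk x hxk hxs
    have hxb := hsub hxs
    rw [ePout] at hxs
    rcases mem_kEdge_cases_lt htb hk hxk with ⟨i, hi, ha⟩ | ⟨i, hi, hc⟩
    · by_cases hF : γ.fc (ta + i) = γ.fc ta
      · -- the arc is the first visit (`i = 0`): coordinates
        have hi0 : i = 0 := by
          by_contra hne
          obtain ⟨-, h1, h2, -, -⟩ := γ.not_straight_of_two_arcs hta (show ta + i < γ.arcs.length by omega) (by omega) hF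
          obtain ⟨-, h1', h2', -, -⟩ := γ.not_straight_of_two_arcs htb (show ta + i < γ.arcs.length by omega) (by omega) (hF.trans hkiss.symm)
          rcases side_mem_of_kiss hta htb (by omega) hkiss (γ.sIn (ta + i)) with e | e | e | e
          · exact h1 e
          · exact h2 e
          · exact h1' e
          · exact h2' e
        subst hi0
        rw [Nat.add_zero, arcSeg] at ha
        change x ∈ segment ℝ (toC (b + (γ.sIn ta).inOff)) (toC (b + (γ.sOut ta).inOff)) at ha
        obtain ⟨t, t', h0, h1, h0', h1', ex, ey⟩ := seg_meet_params hxs ha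
        unfold kLoff at ex ey
        rw [hsep, hs4] at ex ey
        revert hs21 hs21' ex ey
        cases γ.sIn ta <;> cases γ.sOut ta <;> simp [Side.inOff, Side.offset, Side.nIn, Side.opp] <;> intro ex ey <;> nlinarith
      · exact arcSeg_disjoint_faceBox hF ha hxb
    · obtain ⟨s, hs⟩ := crossSeg_faceBox hc hxb
      -- the crossed side of the kiss plaquette is `s₂` (exit of the first visit) or `s₃` (entry of the second)
      obtain ⟨h1a, h2a, -⟩ := γ.side_sIn_nth hta
      obtain ⟨h1b, h2b, -⟩ := γ.side_sIn_nth htb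
      rw [hkiss] at h1b h2b
      have hm : ta + i + 1 = ta + 1 ∨ ta + i + 1 = tb := by
        rcases side_mem_of_kiss hta htb (by omega) hkiss s with e | e | e | e
        · rw [e, h1a] at hs; have := γ.nth_inj (by omega) (by omega) hs; omega
        · rw [e, h2a] at hs; have := γ.nth_inj (by omega) (by omega) hs; omega
        · rw [e, h1b] at hs; have := γ.nth_inj (by omega) (by omega) hs; omega
        · rw [e, h2b] at hs; have := γ.nth_inj (by omega) (by omega) hs; omega
      have hside : γ.nth (ta + i + 1) = (γ.fc ta).side (γ.sOut ta) ∨ γ.nth (ta + i + 1) = (γ.fc ta).side (γ.sIn tb) := by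
        rcases hm with e | e
        · left; rw [e, h2a]
        · right; rw [e, h1b]
      have hc' : x ∈ segment ℝ (toC (b + (γ.sOut ta).inOff)) (toC (b + ((γ.sOut ta).offset - (γ.sOut ta).nIn))) ∨
          x ∈ segment ℝ (toC (b + (γ.sIn tb).inOff)) (toC (b + ((γ.sIn tb).offset - (γ.sIn tb).nIn))) := by
        rcases hside with e | e
        · left; rw [e, crossSeg_side_eq'] at hc; exact hc
        · right; rw [e, crossSeg_side_eq'] at hc; exact hc
      rcases hc' with hc' | hc'
      · obtain ⟨t, t', h0, h1, h0', h1', ex, ey⟩ := seg_meet_params hxs hc'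
        unfold kLoff at ex ey
        rw [hsep, hs4] at ex ey
        revert hs21 hs21' ex ey
        cases γ.sIn ta <;> cases γ.sOut ta <;> simp [Side.inOff, Side.offset, Side.nIn, Side.opp] <;> intro ex ey <;> nlinarith
      · obtain ⟨t, t', h0, h1, h0', h1', ex, ey⟩ := seg_meet_params hxs hc'
        unfold kLoff at ex ey
        rw [hsep, hs4] at ex ey
        revert hs21 hs21' ex ey
        cases γ.sIn ta <;> cases γ.sOut ta <;> simp [Side.inOff, Side.offset, Side.nIn, Side.opp] <;> intro ex ey <;> nlinarith
  -- the side functional in integer coordinates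
  have hSS : ∀ P Q Z : ℤ × ℤ, segSide (toC (b + P)) (toC (b + Q)) (toC (b + Z)) = segSideZ P Q Z := by
    intro P Q Z; rw [segSide_toC, segSideZ_add]
  have hswap : ∀ P Q Z : ℂ, segSide Q P Z = -segSide P Q Z := by
    intro P Q Z; rw [segSide_eq, segSide_eq]; ring
  -- the four integer side values, by cases on the separator type
  have hvals : (0 < segSideZ (γ.kLoff ta tb) (γ.sOut tb).inOff (γ.sIn tb).inOff ∧
        segSideZ (γ.kLoff ta tb) (γ.sOut tb).inOff (γ.sIn ta).inOff < 0 ∧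
        segSideZ (γ.sIn tb).inOff (γ.sIn ta).inOff (γ.kLoff ta tb) < 0 ∧
        0 < segSideZ (γ.sIn tb).inOff (γ.sIn ta).inOff (γ.sOut tb).inOff) ∨
      (0 < segSideZ (γ.sOut tb).inOff (γ.kLoff ta tb) (γ.sIn tb).inOff ∧
        segSideZ (γ.sOut tb).inOff (γ.kLoff ta tb) (γ.sIn ta).inOff < 0 ∧
        segSideZ (γ.sIn tb).inOff (γ.sIn ta).inOff (γ.sOut tb).inOff < 0 ∧
        0 < segSideZ (γ.sIn tb).inOff (γ.sIn ta).inOff (γ.kLoff ta tb)) := by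
    unfold kLoff
    rw [hsep, hs4]
    revert hs21 hs21'
    cases γ.sIn ta <;> cases γ.sOut ta <;> decide
  rcases hvals with ⟨hA, hB, hl, hr⟩ | ⟨hA, hB, hl, hr⟩
  · left
    refine windK_jump_core hab hmiss ?_ ?_ ?_
    · rw [ePinb, ePout, hSS]; exact_mod_cast hA
    · rw [ePina, ePout, hSS]; exact_mod_cast hB
    · rw [ePinb, ePina, ePout]
      exact exists_mem_segment_mem_openSegment (by rw [hSS]; exact_mod_cast hA) (by rw [hSS]; exact_mod_cast hB)
        (by rw [hSS]; exact_mod_cast hl) (by rw [hSS]; exact_mod_cast hr)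
  · right
    have hmiss' : ∀ k, k + 1 < kN ta tb → ∀ x ∈ γ.kEdge ta tb k, x ∉ segment ℝ (toC (γ.ptOut tb)) (toC (b + γ.kLoff ta tb)) := by
      intro k hk x hxk hxs; rw [segment_symm] at hxs; exact hmiss k hk x hxk hxs
    have key := windK_jump_core hab hmiss' (ℓ := toC (γ.ptOut tb)) (r := toC (b + γ.kLoff ta tb))
      (by rw [ePinb, ePout, hSS]; exact_mod_cast hA) (by rw [ePina, ePout, hSS]; exact_mod_cast hB)
      (by
        rw [ePinb, ePina, ePout]
        exact exists_mem_segment_mem_openSegment (by rw [hSS]; exact_mod_cast hA) (by rw [hSS]; exact_mod_cast hB)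
          (by rw [hSS]; exact_mod_cast hl) (by rw [hSS]; exact_mod_cast hr))
    linarith

end YBWalk

end Literature.Probability.RandomPlanarGeometry.SAW.YangBaxter
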